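import Summits.QuantumFields.BalabanUV.Beta.FP.ConstrainedBiLaplacianSbTwoLevelTransfer
import Summits.QuantumFields.BalabanUV.Beta.FP.ConstrainedBiLaplacianSbTwoLevelEstimate

/-!
# `BalabanUV.Beta.FP.ConstrainedBiLaplacianSbTwoLevelRate` — road «FP», brick (g3) «(CONV-C)-Sb», THE TWO-LEG ONE-STEP LAW, FILE R (THE KERNEL LAW):
# THE CELL-SUMMED TWO-LEG DIFFERENCE SYMBOL `Σ_{ρρ′} (L^{d+1}·avgM (n₀k) L s − M (n₀k) s)(Tsub τ₀ ρ, Tsub σ₀ ρ′)` IS `k^{d+1}` TIMES A COARSE ALIAS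
# FORM OF THE TRANSFERRED LETTER DIFFERENCES, IS STRIP REGULAR WITH BOUND `k^{d+1}·CR∕(n₀k)²` (order 2), AND ITS KERNEL OBEYS
# `‖Σ_{ρρ′} (L^{d+1}·latticeKernel (avgM (n₀k) L 2 …) x − latticeKernel (M (n₀k) 2 …) x)‖ ≤ k^{d+1}·CR∕(n₀k)²·e^{−kappaB·|x|_∞}`

NOT IN PRINT; OUR PROOF ATTEMPT (binder row G-an2-4 ∕ (CONV-C), prover part P3 = fibre∕strip «Woodbury» lineage, gen 29; CRUX TEAM (2), 2026-08-21).
HONEST DEPENDENCY (cell records, verbatim): «continuum YM on T⁴ ⇐ BetaPertH ∧ nine spine estimates (0/9 proved); BetaPertH ⇐ (D1) ∧ (D4) ∧ CAP+tail;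
G-an2-4 gates asym, D1 and NE2/3/4.»  HONEST FRAMING (cell contract, verbatim): «discharging `BetaPertH` makes Bałaban's UV stability UNCONDITIONAL — a
real constructive-QFT result; it is NOT the continuum limit and NOT the Clay problem.»  ABSOLUTE RULE (cell charter, verbatim): «No internally-minted
statement may enter as a cited fact. Every hypothesis is either kernel-proved in this package or a verbatim quotation of a PUBLISHED theorem with page
reference. The manuscript(s) under audit are NOT citable for their own disputed steps — they are the thing under adjudication; programme-internal
(2001/route/tribunal) claims are never citable.»  THIS MODULE is [folklore] bookkeeping + our estimates over FILES W∕A1∕A2∕E of this programme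
(`sum_norm_W1_Kof_le`, `PhiDC`∕`trD`∕`trC`∕`sum_sum_PhiDC_Tsub`∕`avgM_transfer_sub_M`, `norm_DgT_sub_Dg_le`∕`norm_coefT_sub_coef_le`), gen 28's FILE 1
(`stripRegular_avgM`, `latticeKernel_avgM`) and row RHOA-4-GH's `ConstrainedBiLaplacianKernel.stripRegular_M`, with [B4]'s contour-shift engine
(`B4ContourShift.latticeKernel_decay`, `StripRegular.add`∕`.mul`, `stripRegular_finsum`); it cites nothing as a hypothesis, has TWO bookkeeping `def`s
(`Dsym`, `CellDsym`) and one closed-form constant (`CR`), no `def … : Prop`, no `sorry`.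

## The mechanism (census V69; journal INTENT «SB-TWO-LEG» 2026-08-21)

The tower over a fixed coarse scale `n₀` compares, at refinement `k → k·L`, the `k^{2(d+1)}` cell pairs of level `n = n₀k`.  Summing the one-step
difference symbol `Dsym n L s τ σ = L^{d+1}·avgM n L s τ σ − M n s τ σ = PhiDC n (DgT − Dg) (coefT − coef) τ σ` (FILE A2) over the cells
`τ = Tsub n₀ k τ₀ ρ`, `σ = Tsub n₀ k σ₀ ρ′` is ONE MORE application of the generic transfer `sum_sum_PhiDC_Tsub`, now at `(n₀, k)`:
**`CellDsym_eq`** `CellDsym n₀ k L s τ₀ σ₀ = k^{d+1}·PhiDC n₀ (trD (DgT − Dg)) (trC (coefT − coef)) τ₀ σ₀`.  FILE W's `L`-UNIFORM weight bound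
(`Σ_m ‖W1 n₀ k (Kof k₀ m)‖ ≤ 2^{d+1}`, free of `k`) and FILE E's unweighted letters (`CD∕n²`, `CC∕n²`) give **`norm_CellDsym_le`**:
`‖CellDsym n₀ k L 2 τ₀ σ₀ p‖ ≤ k^{d+1}·CR (d+1) L n₀∕(n₀k)²` on the strip — one power of `k` better than the `k^{2(d+1)}·n^{−(d+1)}·C∕n²` of the
per-pair route, which is what makes the tower summable in `d + 1 = 4`.  Strip regularity (`stripRegular_CellDsym`, bound re-set to the transferred one) and
the contour shift give the kernel law **`two_leg_cell_kernel_rate`**.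

0∕4 row-D1 binders touched.  NOT (CONV-C), NEVER «G-an2-4 closed», NOT the ghost step law, NOT SDF, NOT D1, NOT BetaPertH, NOT continuum, NOT Clay.
Provenance: prover-b2b-balaban-gan24-p3-g29-0 (unit `b2b-balaban-gan24-p3`, gen 29), 2026-08-21; no existing file touched.
-/

noncomputable section

namespace Summit.QuantumFields.BalabanUV.Beta.FP.ConstrainedBiLaplacianSbTwoLevelRate

open Complex Finset ComplexConjugate MeasureTheory
open Literature.MathematicalPhysics.QuantumFieldTheory.Balaban1983to89
open Literature.MathematicalPhysics.QuantumFieldTheory.Balaban1983to89.B4Strip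
open Literature.MathematicalPhysics.QuantumFieldTheory.Balaban1983to89.B4StripCauchy
open Literature.MathematicalPhysics.QuantumFieldTheory.Balaban1983to89.B4StripSums
open Literature.MathematicalPhysics.QuantumFieldTheory.Balaban1983to89.B4ContourShift
open Summit.QuantumFields.BalabanUV.Beta.FP.ConstrainedBiLaplacianStrip
open Summit.QuantumFields.BalabanUV.Beta.FP.ConstrainedBiLaplacianFibre
open Summit.QuantumFields.BalabanUV.Beta.FP.ConstrainedBiLaplacianFibreEntries
open Summit.QuantumFields.BalabanUV.Beta.FP.ConstrainedBiLaplacianKernel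
open Summit.QuantumFields.BalabanUV.Beta.FP.ConstrainedBiLaplacianFibreIdentities (fat_of_strip)
open Summit.QuantumFields.BalabanUV.Beta.FP.ConstrainedBiLaplacianSubcell (avgM stripRegular_avgM latticeKernel_avgM)
open Summit.QuantumFields.BalabanUV.Beta.FP.ConstrainedBiLaplacianSbTwoLevelSymbols
open Summit.QuantumFields.BalabanUV.Beta.FP.ConstrainedBiLaplacianSbTwoLevel
open Summit.QuantumFields.BalabanUV.Beta.FP.ConstrainedBiLaplacianSbTwoLevelTransfer
open Summit.QuantumFields.BalabanUV.Beta.FP.ConstrainedBiLaplacianSbTwoLevelEstimate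
open Summit.QuantumFields.BalabanUV.Beta.GAN24.SubAveragingCore (Kof Kof_val fat_coord)
open Summit.QuantumFields.BalabanUV.Beta.GAN24.SubAveragingCoreEstimate (W1 norm_W1_le)
open Summit.QuantumFields.BalabanUV.Beta.GAN24.SubAveragingKernel (Tsub stripRegular_finsum)
open Summit.QuantumFields.BalabanUV.Beta.FP.ConstrainedBiLaplacianFibreOperator (Kop)
open scoped Real

variable {d : ℕ}

/-! ## §1 Sup bounds: the alias form, the transferred letters -/

/-- [folklore] **SUP BOUND OF AN ALIAS FORM**: on the fat region, `‖D K‖ ≤ δD`, `‖C K K′‖ ≤ δC` give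
`‖PhiDC N D C τ σ p‖ ≤ 4^d·(δD + 144^d·N^d·δC)` (`‖EF‖, ‖EFc‖ ≤ 2^d`, `‖u_K‖, ‖ũ_K‖ ≤ 12^d`). -/
theorem norm_PhiDC_le (N : ℕ) [NeZero N] {r : ℝ} (hr : r ≤ 1 / 4) {p : Fin d → ℂ} (hp : p ∈ Fat d r)
    (D : (Fin d → Fin N) → ℂ) (C : (Fin d → Fin N) → (Fin d → Fin N) → ℂ) {δD δC : ℝ}
    (hD : ∀ K, ‖D K‖ ≤ δD) (hC : ∀ K K', ‖C K K'‖ ≤ δC) (τ σ : Fin d → Fin N) :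
    ‖PhiDC N p D C τ σ‖ ≤ 4 ^ d * (δD + 144 ^ d * (N : ℝ) ^ d * δC) := by
  have hN : (0 : ℝ) < N := by exact_mod_cast Nat.pos_of_ne_zero (NeZero.ne N)
  have hδD : 0 ≤ δD := (norm_nonneg _).trans (hD fun _ => 0)
  have hδC : 0 ≤ δC := (norm_nonneg _).trans (hC (fun _ => 0) (fun _ => 0))
  have hu : ∀ K : Fin d → Fin N, ‖F N (fun _ => 0) K p‖ ≤ 12 ^ d := fun K =>
    (norm_F_zero_le N hr K hp).trans (by
      calc (∏ ν, 12 / omega N (K ν)) ≤ ∏ _ν : Fin d, (12 : ℝ) := Finset.prod_le_prod (fun ν _ => by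
              have := omega_pos N (K ν) (K ν).isLt; positivity) (fun ν _ => by
              rw [div_le_iff₀ (omega_pos N (K ν) (K ν).isLt)]; nlinarith [one_le_omega N (K ν) (K ν).isLt])
        _ = 12 ^ d := by simp)
  have huc : ∀ K : Fin d → Fin N, ‖Fc N (fun _ => 0) K p‖ ≤ 12 ^ d := fun K =>
    (norm_Fc_zero_le N hr K hp).trans (by
      calc (∏ ν, 12 / omega N (K ν)) ≤ ∏ _ν : Fin d, (12 : ℝ) := Finset.prod_le_prod (fun ν _ => by
              have := omega_pos N (K ν) (K ν).isLt; positivity) (fun ν _ => by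
              rw [div_le_iff₀ (omega_pos N (K ν) (K ν).isLt)]; nlinarith [one_le_omega N (K ν) (K ν).isLt])
        _ = 12 ^ d := by simp)
  have hcard : ((Finset.univ : Finset (Fin d → Fin N)).card : ℝ) = (N : ℝ) ^ d := by
    rw [Finset.card_univ, Fintype.card_pi, Finset.prod_const, Fintype.card_fin, Finset.card_univ, Fintype.card_fin]; push_cast; ring
  have hterm : ∀ K K' : Fin d → Fin N, ‖EF N τ K p * EFc N σ K' p *
      ((if K = K' then D K else 0) - F N (fun _ => 0) K p * Fc N (fun _ => 0) K' p * C K K')‖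
      ≤ 4 ^ d * ((if K = K' then δD else 0) + 144 ^ d * δC) := by
    intro K K'
    rw [norm_mul, norm_mul, show (4 : ℝ) ^ d = 2 ^ d * 2 ^ d by rw [← mul_pow]; norm_num]
    refine mul_le_mul (mul_le_mul (norm_EF_le N hr τ K hp) (norm_EFc_le N hr σ K' hp) (norm_nonneg _) (by positivity)) ?_
      (norm_nonneg _) (by positivity)
    refine (norm_sub_le _ _).trans (add_le_add ?_ ?_)
    · split_ifs
      · exact hD K
      · rw [norm_zero]
    · rw [norm_mul, norm_mul, show (144 : ℝ) ^ d = 12 ^ d * 12 ^ d by rw [← mul_pow]; norm_num]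
      exact mul_le_mul (mul_le_mul (hu K) (huc K') (norm_nonneg _) (by positivity)) (hC K K') (norm_nonneg _) (by positivity)
  unfold PhiDC
  rw [norm_mul, norm_inv, norm_pow, Complex.norm_natCast]
  have hsum : ‖∑ K : Fin d → Fin N, ∑ K' : Fin d → Fin N, EF N τ K p * EFc N σ K' p *
      ((if K = K' then D K else 0) - F N (fun _ => 0) K p * Fc N (fun _ => 0) K' p * C K K')‖
      ≤ (N : ℝ) ^ d * (4 ^ d * (δD + 144 ^ d * (N : ℝ) ^ d * δC)) := by
    have hterm' : ∀ K K' : Fin d → Fin N, ‖EF N τ K p * EFc N σ K' p *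
        ((if K = K' then D K else 0) - F N (fun _ => 0) K p * Fc N (fun _ => 0) K' p * C K K')‖
        ≤ (if K = K' then (4 : ℝ) ^ d * δD else 0) + 4 ^ d * 144 ^ d * δC := fun K K' =>
      (hterm K K').trans (le_of_eq (by split_ifs <;> ring))
    calc _ ≤ ∑ K : Fin d → Fin N, ∑ K' : Fin d → Fin N, ((if K = K' then (4 : ℝ) ^ d * δD else 0) + 4 ^ d * 144 ^ d * δC) :=
          (norm_sum_le _ _).trans (Finset.sum_le_sum fun K _ => (norm_sum_le _ _).trans (Finset.sum_le_sum fun K' _ => hterm' K K'))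
      _ = ∑ K : Fin d → Fin N, (4 ^ d * δD + (N : ℝ) ^ d * (4 ^ d * 144 ^ d * δC)) := by
          refine Finset.sum_congr rfl fun K _ => ?_
          rw [Finset.sum_add_distrib, Finset.sum_ite_eq Finset.univ K, if_pos (Finset.mem_univ _), Finset.sum_const, nsmul_eq_mul, hcard]
      _ = (N : ℝ) ^ d * (4 ^ d * (δD + 144 ^ d * (N : ℝ) ^ d * δC)) := by
          rw [Finset.sum_const, nsmul_eq_mul, hcard]; ring
  calc ((N : ℝ) ^ d)⁻¹ * ‖∑ K : Fin d → Fin N, ∑ K' : Fin d → Fin N, EF N τ K p * EFc N σ K' p *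
        ((if K = K' then D K else 0) - F N (fun _ => 0) K p * Fc N (fun _ => 0) K' p * C K K')‖
      ≤ ((N : ℝ) ^ d)⁻¹ * ((N : ℝ) ^ d * (4 ^ d * (δD + 144 ^ d * (N : ℝ) ^ d * δC))) :=
        mul_le_mul_of_nonneg_left hsum (by positivity)
    _ = 4 ^ d * (δD + 144 ^ d * (N : ℝ) ^ d * δC) := by field_simp

/-- [folklore] **THE TRANSFERRED DIAGONAL LETTER IS `ℓ¹(W1)`-BOUNDED**: `‖D′ K‖ ≤ δ` gives `‖trD n L D′ k‖ ≤ 2^d·δ` on the fat region, UNIFORMLY IN `L`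
(FILE W's `sum_norm_W1_Kof_le`). -/
theorem norm_trD_le (n L : ℕ) [NeZero n] [NeZero L] {r : ℝ} (hr : r ≤ 1 / 4) {p : Fin d → ℂ} (hp : p ∈ Fat d r)
    (D' : (Fin d → Fin (n * L)) → ℂ) {δ : ℝ} (hD : ∀ K, ‖D' K‖ ≤ δ) (k : Fin d → Fin n) : ‖trD n L p D' k‖ ≤ 2 ^ d * δ := by
  have hδ : 0 ≤ δ := (norm_nonneg _).trans (hD (Kof n L k fun _ => 0))
  unfold trD
  calc ‖∑ m : Fin d → Fin L, W1 n L (Kof n L k m) p * D' (Kof n L k m)‖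
      ≤ ∑ m : Fin d → Fin L, ‖W1 n L (Kof n L k m) p‖ * δ := (norm_sum_le _ _).trans (Finset.sum_le_sum fun m _ => by
          rw [norm_mul]; exact mul_le_mul_of_nonneg_left (hD _) (norm_nonneg _))
    _ = (∑ m : Fin d → Fin L, ‖W1 n L (Kof n L k m) p‖) * δ := by rw [Finset.sum_mul]
    _ ≤ 2 ^ d * δ := mul_le_mul_of_nonneg_right (sum_norm_W1_Kof_le n L hr hp k) hδ

/-- [folklore] **THE TRANSFERRED RANK-ONE COEFFICIENT IS `ℓ¹(W1 ⊗ W1)`-BOUNDED**: `‖C′ K K′‖ ≤ δ` gives `‖trC n L C′ k k′‖ ≤ 4^d·δ`, UNIFORMLY IN `L`. -/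
theorem norm_trC_le (n L : ℕ) [NeZero n] [NeZero L] {r : ℝ} (hr : r ≤ 1 / 4) {p : Fin d → ℂ} (hp : p ∈ Fat d r)
    (C' : (Fin d → Fin (n * L)) → (Fin d → Fin (n * L)) → ℂ) {δ : ℝ} (hC : ∀ K K', ‖C' K K'‖ ≤ δ) (k k' : Fin d → Fin n) :
    ‖trC n L p C' k k'‖ ≤ 4 ^ d * δ := by
  have hδ : 0 ≤ δ := (norm_nonneg _).trans (hC (Kof n L k fun _ => 0) (Kof n L k fun _ => 0))
  have hW := sum_norm_W1_Kof_le n L hr hp k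
  have hW' := sum_norm_W1_Kof_le n L hr hp k'
  unfold trC
  calc ‖∑ m : Fin d → Fin L, ∑ m' : Fin d → Fin L, W1 n L (Kof n L k m) p * W1 n L (Kof n L k' m') p * C' (Kof n L k m) (Kof n L k' m')‖
      ≤ ∑ m : Fin d → Fin L, ∑ m' : Fin d → Fin L, ‖W1 n L (Kof n L k m) p‖ * ‖W1 n L (Kof n L k' m') p‖ * δ :=
        (norm_sum_le _ _).trans (Finset.sum_le_sum fun m _ => (norm_sum_le _ _).trans (Finset.sum_le_sum fun m' _ => by
          rw [norm_mul, norm_mul]; exact mul_le_mul_of_nonneg_left (hC _ _) (by positivity)))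
    _ = (∑ m : Fin d → Fin L, ‖W1 n L (Kof n L k m) p‖) * (∑ m' : Fin d → Fin L, ‖W1 n L (Kof n L k' m') p‖) * δ := by
        rw [Finset.sum_mul_sum, Finset.sum_mul]
        exact Finset.sum_congr rfl fun m _ => by rw [Finset.sum_mul]
    _ ≤ 2 ^ d * 2 ^ d * δ := by
        have h0 : 0 ≤ ∑ m' : Fin d → Fin L, ‖W1 n L (Kof n L k' m') p‖ := Finset.sum_nonneg fun _ _ => norm_nonneg _
        exact mul_le_mul_of_nonneg_right (mul_le_mul hW hW' h0 (by positivity)) hδ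
    _ = 4 ^ d * δ := by rw [← mul_pow]; norm_num

/-! ## §2 The cell-summed difference symbol -/

/-- [folklore] THE ONE-STEP DIFFERENCE SYMBOL of the two-leg law: `Dsym n L s τ σ p = L^d·avgM n L s τ σ p − M n s τ σ p`. -/
def Dsym (n L : ℕ) [NeZero n] [NeZero L] (s : ℕ) (τ σ : Fin d → Fin n) (p : Fin d → ℂ) : ℂ :=
  (L : ℂ) ^ d * avgM n L s τ σ p - M n s τ σ p

/-- [folklore] THE CELL-SUMMED DIFFERENCE SYMBOL over the `k^d × k^d` level-`n₀k` cell pairs inside the level-`n₀` cells `(τ₀, σ₀)`: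
`CellDsym n₀ k L s τ₀ σ₀ p = Σ_{ρρ′} Dsym (n₀k) L s (Tsub n₀ k τ₀ ρ) (Tsub n₀ k σ₀ ρ′) p`. -/
def CellDsym (n₀ k L : ℕ) [NeZero n₀] [NeZero k] [NeZero L] (s : ℕ) (τ₀ σ₀ : Fin d → Fin n₀) (p : Fin d → ℂ) : ℂ :=
  ∑ ρ : Fin d → Fin k, ∑ ρ' : Fin d → Fin k, Dsym (n₀ * k) L s (Tsub n₀ k τ₀ ρ) (Tsub n₀ k σ₀ ρ') p

/-- [our proof] **THE CELL-SUMMED DIFFERENCE IS `k^d` TIMES THE COARSE ALIAS FORM OF THE TRANSFERRED LETTER DIFFERENCES** (FILE A2's `avgM_transfer_sub_M` at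
level `n₀k`, then `sum_sum_PhiDC_Tsub` at `(n₀, k)`). -/
theorem CellDsym_eq (n₀ k L : ℕ) [NeZero n₀] [NeZero k] [NeZero L] (s : ℕ) (τ₀ σ₀ : Fin d → Fin n₀) (p : Fin d → ℂ) :
    CellDsym n₀ k L s τ₀ σ₀ p = (k : ℂ) ^ d * PhiDC n₀ p
      (trD n₀ k p (fun K => DgT (n₀ * k) L s p K - Dg (n₀ * k) s p K))
      (trC n₀ k p (fun K K' => coefT (n₀ * k) L s p K K' - coef (n₀ * k) s K K' p)) τ₀ σ₀ := by
  unfold CellDsym Dsym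
  simp_rw [avgM_transfer_sub_M]
  exact sum_sum_PhiDC_Tsub n₀ k p _ _ τ₀ σ₀

/-- [folklore] The constant of the cell-summed law at order 2 (scale `n₀` fixed along the tower). -/
def CR (d L n₀ : ℕ) : ℝ := 4 ^ d * (2 ^ d * CD d L + 144 ^ d * (n₀ : ℝ) ^ d * (4 ^ d * CC d L))

/-- [folklore] `0 ≤ CR`. -/
theorem CR_nonneg (d L n₀ : ℕ) : 0 ≤ CR d L n₀ := by unfold CR; have := CD_nonneg d L; have := CC_nonneg d L; positivity

/-- [our proof] **THE SUP BOUND OF THE CELL-SUMMED DIFFERENCE SYMBOL** at order 2 on the strip: `‖CellDsym n₀ k L 2 τ₀ σ₀ p‖ ≤ k^d·CR d L n₀∕(n₀k)²`. -/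
theorem norm_CellDsym_le (n₀ k L : ℕ) [NeZero n₀] [NeZero k] [NeZero L] {p : Fin d → ℂ} (hp : p ∈ Strip d (kappaB d 2))
    (τ₀ σ₀ : Fin d → Fin n₀) : ‖CellDsym n₀ k L 2 τ₀ σ₀ p‖ ≤ (k : ℝ) ^ d * (CR d L n₀ / (((n₀ * k : ℕ) : ℝ)) ^ 2) := by
  have hfat := fat_of_strip 2 hp
  have hr := rOf_le d
  have hCD := CD_nonneg d L
  have hCC := CC_nonneg d L
  have hN : (0 : ℝ) < ((n₀ * k : ℕ) : ℝ) := by exact_mod_cast Nat.pos_of_ne_zero (NeZero.ne (n₀ * k))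
  have hD : ∀ K : Fin d → Fin (n₀ * k), ‖DgT (n₀ * k) L 2 p K - Dg (n₀ * k) 2 p K‖ ≤ CD d L / (((n₀ * k : ℕ) : ℝ)) ^ 2 :=
    fun K => norm_DgT_sub_Dg_le (n₀ * k) L hp K
  have hC : ∀ K K' : Fin d → Fin (n₀ * k), ‖coefT (n₀ * k) L 2 p K K' - coef (n₀ * k) 2 K K' p‖ ≤ CC d L / (((n₀ * k : ℕ) : ℝ)) ^ 2 :=
    fun K K' => norm_coefT_sub_coef_le (n₀ * k) L hp K K'
  have h1 := norm_trD_le n₀ k hr hfat _ hD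
  have h2 := norm_trC_le n₀ k hr hfat _ hC
  have h3 := norm_PhiDC_le n₀ hr hfat _ _ h1 h2 τ₀ σ₀
  rw [CellDsym_eq, norm_mul, norm_pow, Complex.norm_natCast]
  refine mul_le_mul_of_nonneg_left (h3.trans (le_of_eq ?_)) (by positivity)
  unfold CR
  field_simp

/-! ## §3 Strip regularity and the kernel law (dimension `d+1`) -/

/-- [folklore] Strip regularity of the one-step difference symbol (termwise, crude bound). -/
theorem stripRegular_Dsym (n L : ℕ) [NeZero n] [NeZero L] (s : ℕ) (τ σ : Fin (d + 1) → Fin n) :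
    StripRegular (d := d) (Dsym n L s τ σ) (kappaB (d + 1) s)
      (‖((L : ℂ) ^ (d + 1))‖ * (4 ^ (d + 1) * Kop (d + 1) s * ((L : ℝ) ^ (d + 1))⁻¹) + ‖(-1 : ℂ)‖ * ConstrainedBiLaplacianKernel.boundM n (d + 1) s) := by
  have h1 := (stripRegular_const ((L : ℂ) ^ (d + 1)) (kappaB (d + 1) s)).mul (stripRegular_avgM n L s τ σ) (norm_nonneg _)
  have h2 := (stripRegular_const (-1 : ℂ) (kappaB (d + 1) s)).mul (stripRegular_M n s τ σ) (norm_nonneg _)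
  have h := h1.add h2
  refine ⟨h.cont.congr (fun p _ => by simp [Dsym]; ring), fun i q hq => (h.diff i q hq).congr (fun z _ => by simp [Dsym]; ring), ?_, ?_⟩
  · intro i q hq y hy
    have := h.sides i q hq y hy
    simp only [Dsym] at this ⊢
    linear_combination this
  · intro p hp
    have := h.bound p hp
    simp only [Dsym] at this ⊢
    rw [show (L : ℂ) ^ (d + 1) * avgM n L s τ σ p - M n s τ σ p = (L : ℂ) ^ (d + 1) * avgM n L s τ σ p + (-1) * M n s τ σ p by ring]
    exact this

/-- [our proof] **STRIP REGULARITY OF THE CELL-SUMMED DIFFERENCE SYMBOL WITH THE TRANSFERRED BOUND** `k^{d+1}·CR (d+1) L n₀∕(n₀k)²` (order 2). -/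
theorem stripRegular_CellDsym (n₀ k L : ℕ) [NeZero n₀] [NeZero k] [NeZero L] (τ₀ σ₀ : Fin (d + 1) → Fin n₀) :
    StripRegular (d := d) (CellDsym n₀ k L 2 τ₀ σ₀) (kappaB (d + 1) 2) ((k : ℝ) ^ (d + 1) * (CR (d + 1) L n₀ / (((n₀ * k : ℕ) : ℝ)) ^ 2)) := by
  have h := stripRegular_finsum (Finset.univ : Finset (Fin (d + 1) → Fin k))
    (fun ρ p => ∑ ρ' : Fin (d + 1) → Fin k, Dsym (n₀ * k) L 2 (Tsub n₀ k τ₀ ρ) (Tsub n₀ k σ₀ ρ') p) _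
    (fun ρ _ => stripRegular_finsum (Finset.univ : Finset (Fin (d + 1) → Fin k))
      (fun ρ' p => Dsym (n₀ * k) L 2 (Tsub n₀ k τ₀ ρ) (Tsub n₀ k σ₀ ρ') p) _
      (fun ρ' _ => stripRegular_Dsym (n₀ * k) L 2 (Tsub n₀ k τ₀ ρ) (Tsub n₀ k σ₀ ρ')))
  exact ⟨h.cont, h.diff, h.sides, fun p hp => norm_CellDsym_le n₀ k L hp τ₀ σ₀⟩

/-- [folklore] The kernel of the cell-summed difference symbol is the cell sum of the kernel differences. -/
theorem latticeKernel_CellDsym (n₀ k L : ℕ) [NeZero n₀] [NeZero k] [NeZero L] (s : ℕ) (τ₀ σ₀ : Fin (d + 1) → Fin n₀) (x : Fin (d + 1) → ℤ) :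
    latticeKernel (CellDsym n₀ k L s τ₀ σ₀) x
      = ∑ ρ : Fin (d + 1) → Fin k, ∑ ρ' : Fin (d + 1) → Fin k,
          ((L : ℂ) ^ (d + 1) * latticeKernel (avgM (n₀ * k) L s (Tsub n₀ k τ₀ ρ) (Tsub n₀ k σ₀ ρ')) x
            - latticeKernel (M (n₀ * k) s (Tsub n₀ k τ₀ ρ) (Tsub n₀ k σ₀ ρ')) x) := by
  have hκ0 : 0 ≤ kappaB (d + 1) s := (kappaB_pos (d + 1) s).le
  have hintD : ∀ ρ ρ' : Fin (d + 1) → Fin k, IntegrableOn (integrand (Dsym (n₀ * k) L s (Tsub n₀ k τ₀ ρ) (Tsub n₀ k σ₀ ρ')) x) (BZ (d + 1)) :=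
    fun ρ ρ' => (stripRegular_Dsym (n₀ * k) L s _ _).integrableOn hκ0 x
  have hD : ∀ ρ ρ' : Fin (d + 1) → Fin k, latticeKernel (Dsym (n₀ * k) L s (Tsub n₀ k τ₀ ρ) (Tsub n₀ k σ₀ ρ')) x
      = (L : ℂ) ^ (d + 1) * latticeKernel (avgM (n₀ * k) L s (Tsub n₀ k τ₀ ρ) (Tsub n₀ k σ₀ ρ')) x
        - latticeKernel (M (n₀ * k) s (Tsub n₀ k τ₀ ρ) (Tsub n₀ k σ₀ ρ')) x := by
    intro ρ ρ'
    unfold Dsym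
    have hA : IntegrableOn (integrand (fun P => (L : ℂ) ^ (d + 1) * avgM (n₀ * k) L s (Tsub n₀ k τ₀ ρ) (Tsub n₀ k σ₀ ρ') P) x) (BZ (d + 1)) :=
      ((stripRegular_const ((L : ℂ) ^ (d + 1)) _).mul (stripRegular_avgM (n₀ * k) L s _ _) (norm_nonneg _)).integrableOn hκ0 x
    rw [B4Green242Bridge.latticeKernel_sub x hA ((stripRegular_M (n₀ * k) s _ _).integrableOn hκ0 x), B4Green242Bridge.latticeKernel_const_mul]
  -- outer sum
  have hinner : ∀ ρ : Fin (d + 1) → Fin k, IntegrableOn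
      (integrand (fun P => ∑ ρ' : Fin (d + 1) → Fin k, Dsym (n₀ * k) L s (Tsub n₀ k τ₀ ρ) (Tsub n₀ k σ₀ ρ') P) x) (BZ (d + 1)) := by
    intro ρ
    have : integrand (fun P => ∑ ρ' : Fin (d + 1) → Fin k, Dsym (n₀ * k) L s (Tsub n₀ k τ₀ ρ) (Tsub n₀ k σ₀ ρ') P) x
        = fun p => ∑ ρ' : Fin (d + 1) → Fin k, integrand (Dsym (n₀ * k) L s (Tsub n₀ k τ₀ ρ) (Tsub n₀ k σ₀ ρ')) x p := by
      funext p; unfold integrand; rw [Finset.sum_mul]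
    rw [this]
    exact MeasureTheory.integrable_finsetSum _ fun ρ' _ => hintD ρ ρ'
  have e1 := B4Green244.latticeKernel_sum_mul Finset.univ (fun _ => (1 : ℂ))
    (fun ρ P => ∑ ρ' : Fin (d + 1) → Fin k, Dsym (n₀ * k) L s (Tsub n₀ k τ₀ ρ) (Tsub n₀ k σ₀ ρ') P) x (fun ρ _ => hinner ρ)
  simp only [one_mul] at e1
  unfold CellDsym
  rw [e1]
  refine Finset.sum_congr rfl fun ρ _ => ?_
  have e2 := B4Green244.latticeKernel_sum_mul Finset.univ (fun _ => (1 : ℂ))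
    (fun ρ' => Dsym (n₀ * k) L s (Tsub n₀ k τ₀ ρ) (Tsub n₀ k σ₀ ρ')) x (fun ρ' _ => hintD ρ ρ')
  simp only [one_mul] at e2
  rw [e2]
  exact Finset.sum_congr rfl fun ρ' _ => hD ρ ρ'

/-- [our proof] **THE CELL-SUMMED TWO-LEG KERNEL LAW** (order 2): for every scale `n₀ ≥ 1`, refinement `k ≥ 1`, step `L ≥ 1`, cells `τ₀, σ₀` and block
separation `x`,
`‖Σ_{ρρ′} (L^{d+1}·latticeKernel (avgM (n₀k) L 2 (Tsub τ₀ ρ) (Tsub σ₀ ρ′)) x − latticeKernel (M (n₀k) 2 (Tsub τ₀ ρ) (Tsub σ₀ ρ′)) x)‖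
≤ k^{d+1}·CR (d+1) L n₀∕(n₀k)²·e^{−kappaB (d+1) 2·|x|_∞}`. -/
theorem two_leg_cell_kernel_rate (n₀ k L : ℕ) [NeZero n₀] [NeZero k] [NeZero L] (τ₀ σ₀ : Fin (d + 1) → Fin n₀) (x : Fin (d + 1) → ℤ) :
    ‖∑ ρ : Fin (d + 1) → Fin k, ∑ ρ' : Fin (d + 1) → Fin k,
        ((L : ℂ) ^ (d + 1) * latticeKernel (avgM (n₀ * k) L 2 (Tsub n₀ k τ₀ ρ) (Tsub n₀ k σ₀ ρ')) x
          - latticeKernel (M (n₀ * k) 2 (Tsub n₀ k τ₀ ρ) (Tsub n₀ k σ₀ ρ')) x)‖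
      ≤ (k : ℝ) ^ (d + 1) * (CR (d + 1) L n₀ / (((n₀ * k : ℕ) : ℝ)) ^ 2) * Real.exp (-(kappaB (d + 1) 2 * supNorm x)) := by
  rw [← latticeKernel_CellDsym]
  exact latticeKernel_decay (stripRegular_CellDsym n₀ k L τ₀ σ₀) (kappaB_pos (d + 1) 2).le x

end Summit.QuantumFields.BalabanUV.Beta.FP.ConstrainedBiLaplacianSbTwoLevelRate

end
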